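import Summits.AnomalousDissipation.AnomalousDissipation.Theorems.MomentParityResolvedDissipationStubGalerkinEEaeOfTrajectoryUI
import Summits.AnomalousDissipation.AnomalousDissipation.Theorems.MomentParityResolvedDissipationStubTrajectoryUIOfGalerkinEEae
import Summits.AnomalousDissipation.AnomalousDissipation.Theorems.MomentParityResolvedDissipationTrajectoryUI
import HarnessLib

/-!
# The conjecture-grade leaf of `MomentParity.ResolvedDissipation` is ONE statement in two currencies: TUI ⟺ GEE₀ᵃᵉ
# (crux stmt-AnomalousDissipation-14284; line `enstrophy-ui-transfer`, lead c7)

Supports stmt-AnomalousDissipation-14284 (registered tools stub `trajectoryUI_iff_galerkinEEae`). Nothing here closes an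
item.

* TUI (S1 `stub_trajectoryUI`, global form): `N`-uniform time-integrability of the enstrophy along Galerkin orbits from
  `V`-bounded mean-zero data in the `L²`-ball over one window — finite-dimensional, finite-time, measure-free.
* GEE₀ᵃᵉ (global form): for every `ν > 0` and every smooth divergence-free mean-zero steady force `f`, every coefficientwise
  limit of a Hopf–Galerkin family of NS(ν, f) with the exact force and MEAN-ZERO data, converging strongly in `L²` at time
  `0`, satisfies the energy EQUALITY between a.e. pairs of positive times ("Fourier–Galerkin limits of the forced 3-D NSE
  on `T³` conserve energy exactly, for a.e. pair of times"; Robinson–Rodrigo–Sadowski 2016 Thm 4.6 proves only the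
  strong energy INEQUALITY).

`trajectoryUI_iff_galerkinEEae` : TUI ⟺ GEE₀ᵃᵉ (⟹ `GalerkinEEaeOfTUI.stub_galerkinEEaeOfTrajectoryUI`, lead c7;
⟸ `TrajectoryUIOfGalerkinEEae.stub_trajectoryUIOfGalerkinEEae`, c6's assembly under the weaker leaf). With
`TrajectoryUI.resolvedDissipation_of_trajectoryUI` (c4) the crux follows from either: `resolvedDissipation_of_galerkinEEae`.
Both sides stay conjecture-grade (open: fixed-ν energy equality / no time-concentration for Galerkin limits of 3-D NS);
nothing here is asserted unconditionally about them.
-/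

noncomputable section

-- `Summit.<Summit>.<Problem>`: single-conjunct summit, the duplicate namespace segment is mandated.
set_option linter.dupNamespace false

namespace Summit.AnomalousDissipation.AnomalousDissipation.Theorems.MomentParityResolvedDissipation.TrajectoryUIIffGalerkinEEae

open MeasureTheory Filter Topology Set
open scoped ENNReal InnerProductSpace RealInnerProductSpace
open Literature.Analysis.FunctionSpaces Literature.Analysis.FluidPDE
open Summit.AnomalousDissipation.AnomalousDissipation.Theses.MomentParity
open Summit.AnomalousDissipation.AnomalousDissipation.Theorems.CubicParityLoud.Negative (T3 R3)
open Summit.AnomalousDissipation.AnomalousDissipation.Theorems.MomentParityResolvedDissipation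

/-- **TUI ⟺ GEE₀ᵃᵉ (lead c7).** The trajectory-UI statement S1 of line `enstrophy-ui-transfer` (for all smooth
divergence-free mean-zero forces, all `ν > 0`, all radii) is EQUIVALENT to the energy equality between a.e. pairs of
positive times for coefficientwise limits of Hopf–Galerkin families of the forced 3-D Navier–Stokes equations on `T³`
with the exact steady force and mean-zero data converging strongly at time `0`. (⟹) `stub_galerkinEEaeOfTrajectoryUI`:
no time-concentration (TUI) + no wavenumber escape at bounded levels (pathwise FGT) ⟹ the Galerkin dissipation integrals
converge. (⟸) `stub_trajectoryUIOfGalerkinEEae`: Vitali along a violating sequence. [the equivalence is new in this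
form; ingredients: FoiasGuillopeTemam1981, FMRT2001 Ch. II App. A / Ch. IV (1.31), RobinsonRodrigoSadowski2016 Thm 4.4/4.6] -/
theorem trajectoryUI_iff_galerkinEEae :
    (∀ f : UnitAddTorus (Fin 3) → EuclideanSpace ℝ (Fin 3),
      Torus.IsSmooth f → Torus.IsDivFree f → Torus.HasZeroMean f →
      ∀ ν : ℝ, 0 < ν → ∀ R : ℝ, ∃ T : ℝ, 0 < T ∧
        ∀ G : ℝ≥0∞, G ≠ ⊤ → ∀ ε : ℝ≥0∞, 0 < ε → ∃ M : ℝ≥0∞, M ≠ ⊤ ∧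
          ∀ (N : ℕ) (a : UnitAddTorus (Fin 3) → EuclideanSpace ℝ (Fin 3)),
            IsGalerkinMode N a → Torus.HasZeroMean a → ∫ x, ‖a x‖ ^ 2 ≤ R ^ 2 →
            Torus.eGradNormSq a ≤ G →
            ∫⁻ t in Set.Ioo 0 T, (Set.Ioi M).indicator id
                (Torus.eGradNormSq (Torus.galerkinFlow ν f N t a)) ≤ ε) ↔
    (∀ (ν : ℝ), 0 < ν → ∀ (f : UnitAddTorus (Fin 3) → EuclideanSpace ℝ (Fin 3)),
      Torus.IsSmooth f → Torus.IsDivFree f → Torus.HasZeroMean f →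
      ∀ (u₀ : UnitAddTorus (Fin 3) → EuclideanSpace ℝ (Fin 3)), MemLp u₀ 2 volume →
      ∀ (N : ℕ → ℕ) (U : ℕ → ℝ → UnitAddTorus (Fin 3) → EuclideanSpace ℝ (Fin 3))
        (u : ℝ → UnitAddTorus (Fin 3) → EuclideanSpace ℝ (Fin 3)),
      IsHopfGalerkinFamily ν (fun _ => f) u₀ N (fun _ _ => f) U →
      (∀ n, Torus.HasZeroMean (U n 0)) →
      AEStronglyMeasurable (Torus.stLift u) (volume.restrict (Set.Ioi (0 : ℝ) ×ˢ Set.univ)) →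
      (∀ t, 0 ≤ t → MemLp (u t) 2 volume) →
      (∀ t, 0 ≤ t → ∀ k, Filter.Tendsto
        (fun n => UnitAddTorus.mFourierCoeff (EuclideanSpace.complexify ∘ U n t) k) Filter.atTop
        (𝓝 (UnitAddTorus.mFourierCoeff (EuclideanSpace.complexify ∘ u t) k))) →
      Filter.Tendsto (fun n => eLpNorm (U n 0 - u 0) 2 volume) Filter.atTop (𝓝 0) →
      ∀ᵐ t₀ ∂(volume : Measure ℝ), ∀ᵐ t₁ ∂(volume : Measure ℝ), 0 < t₀ → t₀ ≤ t₁ →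
        Torus.kineticEnergy (u t₁) + ν * (∫⁻ τ in Set.Ioo t₀ t₁, Torus.eGradNormSq (u τ)).toReal =
          Torus.kineticEnergy (u t₀) + ∫ τ in t₀..t₁, ∫ x, ⟪f x, u τ x⟫_ℝ) := by
  constructor
  · intro hTUI ν hν f hf hdiv hf0 u₀ hu₀ N U u hF hmean hum hu hcv h0
    exact GalerkinEEaeOfTUI.stub_galerkinEEaeOfTrajectoryUI ν hν f hf hdiv hf0
      (fun R => hTUI f hf hdiv hf0 ν hν R) u₀ hu₀ N U u hF hmean hum hu hcv h0
  · intro hGEE f hf hdiv hf0 ν hν R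
    exact TrajectoryUIOfGalerkinEEae.stub_trajectoryUIOfGalerkinEEae ν hν f hf hf0 (hGEE ν hν f hf hdiv hf0) R

/-- **GEE₀ᵃᵉ ⟹ `ResolvedDissipation`**: the crux BY NAME from the a.e./mean-zero energy equality for Galerkin limits,
through the Galerkin-intrinsic chain GEE₀ᵃᵉ ⟹ TUI ⟹ U ⟹ RD (`TrajectoryUI.resolvedDissipation_of_trajectoryUI`, c4).
CONDITIONAL on the conjecture-grade GEE₀ᵃᵉ (open for `d = 3`), credits nothing. -/
theorem resolvedDissipation_of_galerkinEEae
    (hGEE : ∀ (ν : ℝ), 0 < ν → ∀ (f : UnitAddTorus (Fin 3) → EuclideanSpace ℝ (Fin 3)),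
      Torus.IsSmooth f → Torus.IsDivFree f → Torus.HasZeroMean f →
      ∀ (u₀ : UnitAddTorus (Fin 3) → EuclideanSpace ℝ (Fin 3)), MemLp u₀ 2 volume →
      ∀ (N : ℕ → ℕ) (U : ℕ → ℝ → UnitAddTorus (Fin 3) → EuclideanSpace ℝ (Fin 3))
        (u : ℝ → UnitAddTorus (Fin 3) → EuclideanSpace ℝ (Fin 3)),
      IsHopfGalerkinFamily ν (fun _ => f) u₀ N (fun _ _ => f) U →
      (∀ n, Torus.HasZeroMean (U n 0)) →
      AEStronglyMeasurable (Torus.stLift u) (volume.restrict (Set.Ioi (0 : ℝ) ×ˢ Set.univ)) →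
      (∀ t, 0 ≤ t → MemLp (u t) 2 volume) →
      (∀ t, 0 ≤ t → ∀ k, Filter.Tendsto
        (fun n => UnitAddTorus.mFourierCoeff (EuclideanSpace.complexify ∘ U n t) k) Filter.atTop
        (𝓝 (UnitAddTorus.mFourierCoeff (EuclideanSpace.complexify ∘ u t) k))) →
      Filter.Tendsto (fun n => eLpNorm (U n 0 - u 0) 2 volume) Filter.atTop (𝓝 0) →
      ∀ᵐ t₀ ∂(volume : Measure ℝ), ∀ᵐ t₁ ∂(volume : Measure ℝ), 0 < t₀ → t₀ ≤ t₁ →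
        Torus.kineticEnergy (u t₁) + ν * (∫⁻ τ in Set.Ioo t₀ t₁, Torus.eGradNormSq (u τ)).toReal =
          Torus.kineticEnergy (u t₀) + ∫ τ in t₀..t₁, ∫ x, ⟪f x, u τ x⟫_ℝ) :
    ResolvedDissipation :=
  TrajectoryUI.resolvedDissipation_of_trajectoryUI (trajectoryUI_iff_galerkinEEae.2 hGEE)

/-- **GEE (c6's all-pairs leaf) ⟹ GEE₀ᵃᵉ**: restricting the families to mean-zero data and the pairs of times to an
a.e. set only weakens the statement. Recorded so that the old leaf sits above the canonical one by a one-line theorem: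
GEE ⟹ GEE₀ᵃᵉ ⟺ TUI. -/
theorem galerkinEEae_of_galerkinLimitEnergyEquality
    (hGEE : ∀ (ν : ℝ), 0 < ν → ∀ (f : UnitAddTorus (Fin 3) → EuclideanSpace ℝ (Fin 3)),
      Torus.IsSmooth f → Torus.IsDivFree f → Torus.HasZeroMean f →
      ∀ (u₀ : UnitAddTorus (Fin 3) → EuclideanSpace ℝ (Fin 3)), MemLp u₀ 2 volume →
      ∀ (N : ℕ → ℕ) (U : ℕ → ℝ → UnitAddTorus (Fin 3) → EuclideanSpace ℝ (Fin 3))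
        (u : ℝ → UnitAddTorus (Fin 3) → EuclideanSpace ℝ (Fin 3)),
      IsHopfGalerkinFamily ν (fun _ => f) u₀ N (fun _ _ => f) U →
      AEStronglyMeasurable (Torus.stLift u) (volume.restrict (Set.Ioi (0 : ℝ) ×ˢ Set.univ)) →
      (∀ t, 0 ≤ t → MemLp (u t) 2 volume) →
      (∀ t, 0 ≤ t → ∀ k, Filter.Tendsto
        (fun n => UnitAddTorus.mFourierCoeff (EuclideanSpace.complexify ∘ U n t) k) Filter.atTop
        (𝓝 (UnitAddTorus.mFourierCoeff (EuclideanSpace.complexify ∘ u t) k))) →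
      Filter.Tendsto (fun n => eLpNorm (U n 0 - u 0) 2 volume) Filter.atTop (𝓝 0) →
      ∀ (t₀ t₁ : ℝ), 0 < t₀ → t₀ ≤ t₁ →
        Torus.kineticEnergy (u t₁) + ν * (∫⁻ τ in Set.Ioo t₀ t₁, Torus.eGradNormSq (u τ)).toReal =
          Torus.kineticEnergy (u t₀) + ∫ τ in t₀..t₁, ∫ x, ⟪f x, u τ x⟫_ℝ) :
    ∀ (ν : ℝ), 0 < ν → ∀ (f : UnitAddTorus (Fin 3) → EuclideanSpace ℝ (Fin 3)),
      Torus.IsSmooth f → Torus.IsDivFree f → Torus.HasZeroMean f →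
      ∀ (u₀ : UnitAddTorus (Fin 3) → EuclideanSpace ℝ (Fin 3)), MemLp u₀ 2 volume →
      ∀ (N : ℕ → ℕ) (U : ℕ → ℝ → UnitAddTorus (Fin 3) → EuclideanSpace ℝ (Fin 3))
        (u : ℝ → UnitAddTorus (Fin 3) → EuclideanSpace ℝ (Fin 3)),
      IsHopfGalerkinFamily ν (fun _ => f) u₀ N (fun _ _ => f) U →
      (∀ n, Torus.HasZeroMean (U n 0)) →
      AEStronglyMeasurable (Torus.stLift u) (volume.restrict (Set.Ioi (0 : ℝ) ×ˢ Set.univ)) →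
      (∀ t, 0 ≤ t → MemLp (u t) 2 volume) →
      (∀ t, 0 ≤ t → ∀ k, Filter.Tendsto
        (fun n => UnitAddTorus.mFourierCoeff (EuclideanSpace.complexify ∘ U n t) k) Filter.atTop
        (𝓝 (UnitAddTorus.mFourierCoeff (EuclideanSpace.complexify ∘ u t) k))) →
      Filter.Tendsto (fun n => eLpNorm (U n 0 - u 0) 2 volume) Filter.atTop (𝓝 0) →
      ∀ᵐ t₀ ∂(volume : Measure ℝ), ∀ᵐ t₁ ∂(volume : Measure ℝ), 0 < t₀ → t₀ ≤ t₁ →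
        Torus.kineticEnergy (u t₁) + ν * (∫⁻ τ in Set.Ioo t₀ t₁, Torus.eGradNormSq (u τ)).toReal =
          Torus.kineticEnergy (u t₀) + ∫ τ in t₀..t₁, ∫ x, ⟪f x, u τ x⟫_ℝ :=
  fun ν hν f hf hdiv hf0 u₀ hu₀ N U u hF _ hum hu hcv h0 =>
    Eventually.of_forall fun t₀ => Eventually.of_forall fun t₁ ht₀ ht₀₁ =>
      hGEE ν hν f hf hdiv hf0 u₀ hu₀ N U u hF hum hu hcv h0 t₀ t₁ ht₀ ht₀₁

end Summit.AnomalousDissipation.AnomalousDissipation.Theorems.MomentParityResolvedDissipation.TrajectoryUIIffGalerkinEEae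

end
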